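import Mathlib
import Summits.NavierStokesRegularity.NavierStokesRegularity.Theses.AmplitudeIndex
import Literature.Analysis.FluidPDE.NSKatoToClayHolds
import HarnessLib

/-!
# Route AmplitudeIndex — support item `KatoToClay` PROVED (stmt-NavierStokesRegularity-10568;
  shared verbatim with `MarginalTypeI.KatoToClay`)

The item is verbatim the tree's named fact `clay_solution_of_hasGlobalKatoSolution` (PROVED:
`clay_solution_of_hasGlobalKatoSolution_holds`; Kato 1984 Thm 4 with Lemarié-Rieusset 2002
Ch. 15/27): a global Kato solution from a Clay datum upgrades to a Clay (A) solution. One-line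
closure by name.

HONEST FRAMING: bookkeeping over a PROVED tree fact; nothing here bears on the regularity question.
Lands `--workitem stmt-NavierStokesRegularity-10568` (typer seat g19 of cell pub-ns-dss, idle-row
item).
-/

namespace Summit.NavierStokesRegularity.NavierStokesRegularity.Theorems

set_option linter.dupNamespace false

/-- **`KatoToClay` of route AmplitudeIndex (stmt-NavierStokesRegularity-10568)** = the tree's
`clay_solution_of_hasGlobalKatoSolution_holds`, by name. [this file] -/
theorem amplitudeIndex_katoToClay_proof : Theses.AmplitudeIndex.KatoToClay :=
  Literature.Analysis.FluidPDE.clay_solution_of_hasGlobalKatoSolution_holds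

end Summit.NavierStokesRegularity.NavierStokesRegularity.Theorems
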